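import Summits.QuantumAdvantage.AdviceFreeQNC0.TensorMultZero
import Summits.QuantumAdvantage.AdviceFreeQNC0.TensorBlockSplit
import Summits.QuantumAdvantage.AdviceFreeQNC0.WalkFailFloor
import HarnessLib

/-!
# Cell qa-qnc0 (rung F-Q1, route RingFrame, crux α `RingToElim` / density target T10): the DEGREE-0
# TENSOR FLOOR made explicit — every degree-`D` walk strategy on `n ≥ m₀(D+2)` bits fails on
# `≥ β^{D+2}·2ⁿ` inputs, `β = (1 − 2/2^{m₀})/3 ↑ 1/3`; `RingFailLinearWalk c` for EVERY `c > log₂ 3`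

Planner qa-qnc0-p1's density axis (ROUND-11 §1.1: `φ(ℓ, D) ≥ 2^{−a·D}` in the linear window
`ℓ = λD`; "best known exponent `log₂ 3` (TARGET §16.0 (iv))"; T10 = exponent `< 1`).  The two
ingredients of the `log₂ 3` floor are in the tree — BLOCK SPLITTING `blockSplit 0`
(`TensorBlockSplit.lean`, prover qa-qnc0-prover gen 7: a degree-`D` strategy cut into `k = D+2`
blocks has its WIN pattern in the `k`-block sum code at block degree `0`) and the degree-`0`
tensor bound `SumCodeZero.pow_mul_le_card_fails` / `tensorMult_zero` (`TensorMultZero.lean`,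
prover qa-qnc0-prover-2 gen 0: such patterns fail on `≥ β^k·2ⁿ` inputs when the blocks have
`≥ m₀` bits, `β ≤ (1 − 2/2^{m₀})/3`) — but their composite was stated only through the conditional
`t10W_of_tensorMult`, whose hypothesis `β > 2^{−(t+1)} = 1/2` is void at `t = 0`.  This file
states the unconditional floor:

* `sumCodeWin_zero_failCount_ge` — `tensorMult_zero` with the scale `m₀` EXPOSED (same proof);
* **`ringWinU_fail_tensorZero`** — `β^{D+2}·2ⁿ ≤ #FAIL` for every walk strategy of `𝔽₂`-degree
  `≤ D` on `n ≥ m₀(D+2)` bits, every charge, whenever `0 ≤ β ≤ (1 − 2/2^{m₀})/3`, `m₀ ≥ 1`;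
  `card_ringWinU_le_tensorZero` (`#WIN ≤ (1 − β^{D+2})·2ⁿ`); the instance
  **`ringWinU_fail_tensorZero_eight`**: `(127/384)^{D+2}·2ⁿ ≤ #FAIL` for `n ≥ 8(D+2)`
  (`127/384 = 0.3307…`, i.e. `2^{−1.596(D+2)}·2ⁿ`);
* **`mixedHardAt_tensorZero`** — `MixedHardAt ℓ D (1 − β^{D+3})` for `ℓ ≥ m₀(D+3)` (even triples
  are walk strategies of degree `D+1`);
* **`ringFailLinearWalk_of_logb_lt`** — `RingFailLinearWalk c` for EVERY `c > log₂ 3`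
  (`β = 2^{−c₁}`, `c₁ = (c + log₂3)/2`, `λ = 3m₀(β)`, `D₀ = max 1 ⌈2c₁/(c − c₁)⌉`): the planner's
  "best known exponent `log₂ 3`" as a kernel statement in the shape of `T10W` (which asks `c < 1`).

Numbers (deficit bits `−log₂(#FAIL/2ⁿ)` at degree `D`, window `n`): fail floor (gen 5) `2D+3`
(`n ≥ 2D+3`); fail-set hits (gen 6) `40.1` at `D = 20` (`n ≥ 59`), `→ 1.757·D`; this file at
`m₀ = 8`: `1.596·(D+2)`, i.e. `35.1` at `D = 20` (`n ≥ 176`), `130.9` at `D = 80` (`n ≥ 656`), and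
`→ (log₂3 + ε)·D` as `m₀ → ∞` (`n ≥ m₀(D+2)`).  The cell's theorem (planner qa-qnc0-p1 TARGET
§16.0(iv)/ROUND-12 §2 statement; provers qa-qnc0-prover g7 / qa-qnc0-prover-2 g0 ingredients;
prover qn-prover-3 gen 6 composite), 2026-08-27; not in print.  WHAT THIS IS NOT: exponent
`log₂ 3 + ε > 1` — `T10W` / T10 (exponent `< 1`), MULT₁ and crux α are untouched; no separation claim.
-/

noncomputable section

namespace Summit.QuantumAdvantage.AdviceFreeQNC0

open Finset
open Literature.Computability.MetaComplexity Literature.Computability.MetaComplexity.Smolensky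
open TensorMultZero

/-! ### The degree-0 tensor bound with the scale exposed -/

/-- `tensorMult_zero` with the block scale `m₀` exposed: every win pattern of the `k`-block sum
code at block degree `0`, blocks of sizes `≥ m₀` (`m₀·k ≤ n`), fails on `≥ β^k·2ⁿ` inputs whenever
`0 ≤ β ≤ (1 − 2/2^{m₀})/3`.  (Proof = prover qa-qnc0-prover-2 gen 0's `tensorMult_zero`, verbatim
after the choice of scale.) -/
theorem sumCodeWin_zero_failCount_ge {m₀ : ℕ} {β : ℝ} (hβ0 : 0 ≤ β)
    (hβ : β ≤ (1 - 2 / (2 : ℝ) ^ m₀) / 3) {n k : ℕ} (hk : 0 < k) (hn : m₀ * k ≤ n)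
    {win : (Fin n → Bool) → Bool} (hwin : SumCodeWin n k 0 win) :
    β ^ k * (2 : ℝ) ^ n ≤ (failCount win : ℝ) := by
  classical
  obtain ⟨X, hX, hw⟩ := hwin
  have hex : ∀ j : ℕ, ∃ T : ℕ → (Fin n → Bool) → Bool, j < k →
      (∀ r, HasBlockDeg n k j 0 (T r)) ∧ (∀ u, xor (T 0 u) (xor (T 1 u) (T 2 u)) = false) ∧
        ∀ u, X j u = T (blockWt n k j u % 3) u := by
    intro j
    by_cases hj : j < k
    · obtain ⟨T, h1, h2, h3⟩ := hX j hj
      exact ⟨T, fun _ => ⟨h1, h2, h3⟩⟩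
    · exact ⟨fun _ _ => false, fun h => absurd h hj⟩
  choose T hT using hex
  have hoff : ∀ j < k, ∀ (r : ℕ) (u a : Fin n → Bool),
      T j r (SumCodeZero.ovr (blockIdx n k) j u a) = T j r u :=
    fun j hj r u a => apply_mergeBlock_of_hasBlockDeg_zero ((hT j hj).1 r) u a
  have heven : ∀ j < k, ∀ u : Fin n → Bool, xor (T j 0 u) (xor (T j 1 u) (T j 2 u)) = false :=
    fun j hj u => (hT j hj).2.1 u
  have hm : ∀ j < k, m₀ ≤ (univ.filter fun i : Fin n => blockIdx n k i = j).card :=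
    fun j hj => SumCodeZero.le_card_blockIdx hk hn hj
  have key := SumCodeZero.pow_mul_le_card_fails (bl := blockIdx n k) k T hoff heven hm hβ0 hβ
  have hfc : failCount win = (SumCodeZero.fails (blockIdx n k) k T).card := by
    unfold failCount SumCodeZero.fails
    congr 1
    ext u
    simp only [mem_filter, mem_univ, true_and]
    rw [hw u]
    unfold SumCodeZero.win
    have hf : ((range k).filter fun j => X j u = true) =
        (range k).filter fun j => T j (SumCodeZero.bw (blockIdx n k) j u % 3) u = true :=
      filter_congr fun j hj => by rw [(hT j (mem_range.1 hj)).2.2 u]; rfl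
    rw [hf]
  rw [hfc]
  exact key

/-! ### The floor for walk strategies -/

/-- **THE DEGREE-0 TENSOR FLOOR.**  Every walk strategy of `𝔽₂`-degree `≤ D` on `n ≥ m₀(D+2)` bits
(`m₀ ≥ 1`) fails on at least `β^{D+2}·2ⁿ` inputs, for every charge, whenever
`0 ≤ β ≤ (1 − 2/2^{m₀})/3`: block splitting into `D+2` blocks (`blockSplit 0`) and the degree-`0`
tensor bound. [folklore] -/
theorem ringWinU_fail_tensorZero {m₀ : ℕ} (hm₀ : 1 ≤ m₀) {β : ℝ} (hβ0 : 0 ≤ β)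
    (hβ : β ≤ (1 - 2 / (2 : ℝ) ^ m₀) / 3) (D : ℕ) {n : ℕ} (hn : m₀ * (D + 2) ≤ n) (c : ℕ)
    (y : Fin (n + 1) → (Fin n → Bool) → Bool) (hy : ∀ g, HasDeg (y g) D) :
    β ^ (D + 2) * (2 : ℝ) ^ n ≤
      ((univ.filter fun u : Fin n → Bool => ringWinU c y u = false).card : ℝ) := by
  have hkn : D + 2 ≤ n := le_trans (Nat.le_mul_of_pos_left (D + 2) hm₀) hn
  have hsc : SumCodeWin n (D + 2) 0 (ringWinU c y) :=
    blockSplit 0 n (D + 2) D c y (by omega) hkn (by omega) hy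
  have h := sumCodeWin_zero_failCount_ge hβ0 hβ (by omega) hn hsc
  unfold failCount at h
  exact h

/-- **The win count under the degree-0 tensor floor**: `#WIN ≤ (1 − β^{D+2})·2ⁿ`. [folklore] -/
theorem card_ringWinU_le_tensorZero {m₀ : ℕ} (hm₀ : 1 ≤ m₀) {β : ℝ} (hβ0 : 0 ≤ β)
    (hβ : β ≤ (1 - 2 / (2 : ℝ) ^ m₀) / 3) (D : ℕ) {n : ℕ} (hn : m₀ * (D + 2) ≤ n) (c : ℕ)
    (y : Fin (n + 1) → (Fin n → Bool) → Bool) (hy : ∀ g, HasDeg (y g) D) :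
    ((univ.filter fun u : Fin n → Bool => ringWinU c y u = true).card : ℝ) ≤
      (1 - β ^ (D + 2)) * (2 : ℝ) ^ n := by
  have hfl := ringWinU_fail_tensorZero hm₀ hβ0 hβ D hn c y hy
  have htot := TensorBlocks.failCount_add_card_win (ringWinU c y)
  unfold failCount at htot
  have htotR : ((univ.filter fun u : Fin n → Bool => ringWinU c y u = false).card : ℝ) +
      ((univ.filter fun u : Fin n → Bool => ringWinU c y u = true).card : ℝ) = (2 : ℝ) ^ n := by
    exact_mod_cast htot
  rw [sub_mul, one_mul]
  linarith

/-- **Instance `m₀ = 8`** (`β = 127/384 = 0.3307…`): every walk strategy of degree `≤ D` on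
`n ≥ 8(D+2)` bits fails on `≥ (127/384)^{D+2}·2ⁿ = 2^{−1.596…·(D+2)}·2ⁿ` inputs. [folklore] -/
theorem ringWinU_fail_tensorZero_eight (D : ℕ) {n : ℕ} (hn : 8 * (D + 2) ≤ n) (c : ℕ)
    (y : Fin (n + 1) → (Fin n → Bool) → Bool) (hy : ∀ g, HasDeg (y g) D) :
    (127 / 384 : ℝ) ^ (D + 2) * (2 : ℝ) ^ n ≤
      ((univ.filter fun u : Fin n → Bool => ringWinU c y u = false).card : ℝ) :=
  ringWinU_fail_tensorZero (m₀ := 8) (by norm_num) (by norm_num) (by norm_num) D hn c y hy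

/-! ### The mixed game -/

/-- **The degree-0 tensor floor of the mixed game**: `MixedHardAt ℓ D (1 − β^{D+3})` for
`ℓ ≥ m₀(D+3)` (an even triple of degree `≤ D` is a walk strategy of degree `D+1`,
`evenTriple_isWalkRow`). [folklore] -/
theorem mixedHardAt_tensorZero {m₀ : ℕ} (hm₀ : 1 ≤ m₀) {β : ℝ} (hβ0 : 0 ≤ β)
    (hβ : β ≤ (1 - 2 / (2 : ℝ) ^ m₀) / 3) (D : ℕ) {ℓ : ℕ} (hℓ : m₀ * (D + 3) ≤ ℓ) :
    MixedHardAt ℓ D (1 - β ^ (D + 3)) := by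
  intro c P y hPdeg hPeven hy
  have hℓ1 : 1 ≤ ℓ := le_trans hm₀ (le_trans (Nat.le_mul_of_pos_right m₀ (by omega)) hℓ)
  obtain ⟨yP, hyP, hwin⟩ := evenTriple_isWalkRow ℓ hℓ1 c D P ⟨hPdeg, hPeven⟩
  have e : (univ.filter fun w : Fin ℓ → Bool => mixedWinU c P y w = true) =
      univ.filter fun w : Fin ℓ → Bool => ringWinU c (fun g w => xor (yP g w) (y g w)) w = true := by
    refine Finset.filter_congr fun w _ => ?_
    unfold mixedWinU
    have hw : P (wt w % 3) w = ringWinU c yP w := hwin w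
    rw [hw, ringWinU_xor]
  rw [e]
  have hdeg : ∀ g, HasDeg ((fun g w => xor (yP g w) (y g w)) g) (D + 1) := fun g =>
    hasDeg_xor (hyP g) (hasDeg_of_le (hy g) (Nat.le_succ _))
  exact card_ringWinU_le_tensorZero hm₀ hβ0 hβ (D + 1) (n := ℓ) hℓ c _ hdeg

/-! ### `RingFailLinearWalk c` for every `c > log₂ 3` -/

/-- **The density axis at exponent `log₂ 3 + ε`**: `RingFailLinearWalk c` holds for every
`c > log₂ 3` — for `D ≥ D₀` and `n ≥ λD`, every degree-`D` walk strategy wins on at most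
`(1 − 2^{−cD})·2ⁿ` inputs (planner qa-qnc0-p1 ROUND-11 §1.1's "best known exponent"; `T10W` asks
for some `c < 1`). [folklore] -/
theorem ringFailLinearWalk_of_logb_lt {c : ℝ} (hc : Real.logb 2 3 < c) : RingFailLinearWalk c := by
  -- the ratio `β = 2^{-c₁}` with `log₂ 3 < c₁ < c`
  set c₁ : ℝ := (c + Real.logb 2 3) / 2 with hc₁
  have hc₁lt : c₁ < c := by rw [hc₁]; linarith
  have hc₁gt : Real.logb 2 3 < c₁ := by rw [hc₁]; linarith
  have hlog3 : 0 < Real.logb 2 3 := Real.logb_pos (by norm_num) (by norm_num)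
  have hc₁pos : 0 < c₁ := hlog3.trans hc₁gt
  set β : ℝ := (2 : ℝ) ^ (-c₁) with hβ
  have hβ0 : 0 ≤ β := Real.rpow_nonneg (by norm_num) _
  have hβ3 : β < 1 / 3 := by
    have h13 : (2 : ℝ) ^ (-Real.logb 2 3) = 1 / 3 := by
      rw [Real.rpow_neg (by norm_num), Real.rpow_logb (by norm_num) (by norm_num) (by norm_num)]
      norm_num
    rw [hβ, ← h13]
    exact Real.rpow_lt_rpow_of_exponent_lt (by norm_num) (by linarith)
  obtain ⟨m₀, hm₀1, hm₀⟩ := exists_scale hβ3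
  have hβ' : β ≤ (1 - 2 / (2 : ℝ) ^ m₀) / 3 := by linarith
  -- thresholds
  refine ⟨3 * m₀, max 1 (Nat.ceil (2 * c₁ / (c - c₁))), fun D hD n hn ch y hy => ?_⟩
  have hD1 : 1 ≤ D := le_trans (le_max_left _ _) hD
  have hDceil : 2 * c₁ / (c - c₁) ≤ (D : ℝ) :=
    le_trans (Nat.le_ceil _) (by exact_mod_cast le_trans (le_max_right _ _) hD)
  have hn' : m₀ * (D + 2) ≤ n := by
    have : m₀ * (D + 2) ≤ 3 * m₀ * D := by nlinarith
    exact le_trans this hn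
  have hwin := card_ringWinU_le_tensorZero hm₀1 hβ0 hβ' D hn' ch y hy
  -- `2^{-cD} ≤ β^{D+2}`
  have hexp : (2 : ℝ) ^ (-(c * (D : ℝ))) ≤ β ^ (D + 2) := by
    have e : β ^ (D + 2) = (2 : ℝ) ^ (-c₁ * ((D : ℝ) + 2)) := by
      rw [hβ, ← Real.rpow_natCast, ← Real.rpow_mul (by norm_num)]
      push_cast
      ring_nf
    rw [e]
    refine Real.rpow_le_rpow_of_exponent_le (by norm_num) ?_
    have hcc : 0 < c - c₁ := by linarith
    have h1 : 2 * c₁ ≤ (c - c₁) * (D : ℝ) := by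
      rw [div_le_iff₀ hcc] at hDceil
      linarith
    nlinarith
  have h2n : (0 : ℝ) ≤ (2 : ℝ) ^ n := by positivity
  calc ((univ.filter fun u : Fin n → Bool => ringWinU ch y u = true).card : ℝ)
      ≤ (1 - β ^ (D + 2)) * (2 : ℝ) ^ n := hwin
    _ ≤ (1 - (2 : ℝ) ^ (-(c * (D : ℝ)))) * (2 : ℝ) ^ n :=
        mul_le_mul_of_nonneg_right (by linarith) h2n

end Summit.QuantumAdvantage.AdviceFreeQNC0

end
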